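/-
Copyright: lit-balaban READER/TYPER seat r18 (gen 13).  Statement-level skeleton of a published paper; no proof claims beyond what
the kernel checks below.
-/
import Literature.MathematicalPhysics.QuantumFieldTheory.BalabanImbrieJaffe1984to88.BIJ88CurlyDkLocTorus
import Literature.MathematicalPhysics.QuantumFieldTheory.BalabanJaffe1986.BJ86TranslInv246Torus

/-!
# `BalabanImbrieJaffe1984to88.BIJ88Sect2TranslInvTorus` — T. Bałaban, J. Imbrie, A. Jaffe, *Effective action and cluster properties of
the abelian Higgs model*, Commun. Math. Phys. **114** (1988) 257–315 [BalabanImbrieJaffe1988], §2 pp. 260–261: the three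
«TRANSLATION INVARIANT» clauses of the localized kernels — (2.1) *"Construct a translation invariant localization function ζ_k"*,
p. 260 *"H_k is also translation invariant"*, p. 261 *"and extend by translation invariance to T₁^{(k)}"* — PROVED ON THE TORI OF THE
SERIES FOR THE CONCRETE OBJECTS OF RECORD of `BIJ88CurlyDkLocTorus` (`hdist`, `hKer`, (2.4) `hlKer`, `cKer` = [I] (4.3.3) `C^{(j)}`,
(2.8) `ctKer`, (2.9) `clKer`, (2.12) `termKer`/`dkLocKer`), together with the translation covariance of the unit-step objects they are
built from: the surface pull-back `Q^{s*}_j` (2.17)/(2.24), the axial minimizer `H_{j,Ax}` (4.1.3) and the unit-lattice covariance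
`C^{(j)}` (4.3.3) of [BalabanImbrieJaffe1985] (= [I])

statement-level skeleton of published theorems with citation tags; proofs where landed; nothing here is a claim about the Yang–Mills mass gap

PDF held: `paper:balaban1988-cmp114-bij-abelian-higgs-effective-action` (journal page = PDF page + 256); pp. 260–261 [PDF 4–5] re-read
this session from the materialised text layer (`~/.lit/texts/…/p0004.txt`, `p0005.txt`).

CITATION HEADER (lean-in-tree rule).  Phase-2 file of the lit-balaban TYPED SKELETON (HOME `run/shared/lean/pub/lit-balaban/`), seat r18
gen 13 (unit `lit-balaban-r18`, the C2 §§1–4 fold owner; TAKING line HOME/STATUS.md 2026-08-22T02:31:04Z); rows **C2.Eq2.1**, **C2.Eq2.4**,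
**C2.Eq2.8**, **C2.Eq2.9**, **C2.Eq2.12** of `HOME/lit-balaban-r18/ROWS-C2.md` (DEF rows, cells only; referee ref-5), and members of r15's
rows C1.Eq4.1.3-4.1.5 / C1.Eq4.3.1-4.3.3 / C1.Eq4.4.4 / C1.Prop5.2.1 / C1.Eq2.13–C1.Eq2.17 / C1.Eq2.24 (the translation covariance of `H_{j,Ax}`,
`C^{(j)}`, `𝒟_k`, `G_{k,Ax}`, `Q`, `Q^*`, `Q^s`, `Q^{s*}`, `Q^{s*}_k` on the tori).
INPUTS, all landed, BY NAME (nothing restated): r18 g10 `BIJ88CurlyDkLocTorus` (the objects), p33 `BIJ85SigmaTranslationInvariance` (the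
translation actions `translV`, the isometries `bondTransl`/`plaqTransl`, `bondAvg_transl`, `isAxial_transl_iff`, `bondTransl_mem_V411_iff`,
`curlOp_bondTransl`, `translV_eq_zero_iff`), p27 g10 `BalabanJaffe1986.BJ86TranslInv246Torus` (`coarseTransl`, `coarseTransl_single`,
**`HkE_translate`** — the Landau minimizer commutes with the translations), p27 g4 `BIJ85Sigma422Equivariance` (`adjoint_intertwine`,
`axialPropagator_equivariant`), p30 `BIJ85Prop521Proof`/`BIJ85Prop521Torus` (`HaxOp`, `noZeroModes_DH`, `Wstep`, `QcE`, `QsE`, `factor_V411`),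
p11 `BIJ85Prop522Torus` (`HaxE`, `CE`, `HkE`, `hD_V411`), p09 `BIJ85Ineq722Torus` (`ctr`, `distEU`, `sitesPerDir_zero_eq`), p31
`BIJ85Eq213Adjoint` (`qKer`, `qstKer`, `bondAvg_eq_sum_qKer`), r15 `BIJ85Sect2SurfaceAverages`/`BIJ85Eq219Proof` (`BlockBonds.Bs`, `Qsstar`,
`torusBlockBonds`, `mem_Bs_iff`), `BIJ88Eq211Proof` (`qsKer`, `qsstKer`, `clocKer`), p30 `BIJ85Eq531Inputs.QsstarIter`, p13 `BIJ88Cutoffs21`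
(`cutoff`, `cutoff_congr_dist`), r09 `B12GaugeFixInvariance269.blockOf_add_scale`, `T4Covariance` (`Site.scale`, `Site.scaleTo`),
`TorusLimitAxioms` (`PBond.translate`, `Site.add_apply`, `Site.shift_add`), `LatticeFieldCalculus.supDist`.

THE PRINTED TEXT (verbatim).  p. 260 [PDF 4]: *"Construct a translation invariant localization function ζ_k such that ζ_k(b, b′) = 0, if
dist(b, b′) ≧ ⅛r(e_k), 1, if dist(b, b′) ≦ (1/16)r(e_k), (2.1) and such that ζ_k is a smooth function of b. Here b ∈ T_η, b′ ∈ T₁^{(k)}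
… Then the localized version of H_k has a kernel H_{k,loc}(b, b′) = ζ_k(b, b′)H_k(b, b′). (2.4) There is no ambiguity because ζ_k permits
a sampling only of b near b′, relative to the size of T_{0,η}; H_k is also translation invariant."*  p. 261 [PDF 5]: *"Next we consider
C^{(k)}, the covariance of the k-th step gauge field. This is defined on the unit lattice T^{(k)}_{0,1}. First define C̃^{(k)}(b₁, b₂) =
C^{(k)}(b₁, b₂), if dist(b₁, b₂) ≦ ¼r(e_k), 0, otherwise, (2.8) and extend by translation invariance to T₁^{(k)}. Then put C^{(k)}_{loc} =
(I − Q^{s*}Q)C̃^{(k)}(I − Q*Q^s); (2.9) … 𝒟_{k,loc} = Σ_{j=0}^{k−1} H^{L^jη}_{j,loc}C^{(j),L^jη}_{loc}H^{*L^jη}_{j,loc} (2.12)"*.  [I] p. 321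
[PDF 23]: *"Since we study periodic boundary conditions, σ_k is translation invariant."*

THE TRANSLATIONS OF THE TORI (conventions of p33/p27, nothing new).  A lattice vector `v ∈ T^{(j)}` (`Balaban1983to89.Site P j`, an
additive group) acts on bonds by `b ↦ b + v` (`PBond.translate`) and on bond fields by `(τ_vA)(b) = A(b + v)` (`translV`; as isometries
`bondTransl` on the `η`-bonds, `coarseTransl j` on the bonds of `T^{(j)}`).  The block structure admits exactly the translations by
block-lattice vectors: a vector `a ∈ T^{(j+1)}` acts on `T^{(j)}` by its fine vector `L·a = Site.scale a` (blocks go to blocks,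
`blockOf_add_scale`), and `t ∈ T^{(k)}` acts on the `η`-lattice `T^{(0)}` by `L^k·t = Site.scaleTo k t`.

WHAT IS PROVED (0 `sorry`, standard axioms; THEOREMS ONLY — no `def`, no `structure`, no new named `Prop` fact; D-0026).
* §1 GEOMETRY: `supDist_translate` (the `ℓ^∞` torus distance is translation invariant), `scaleTo_apply` (`(L^k·t)_μ = t_μL^k` in the standing
  range), **`ctr_add`** (block centres go to block centres: `ctr(y + t) = ctr(y) + L^k·t`), **`hdist_translate`** (the (2.1)/(2.4) distance
  `dist(b + L^jt, b′ + t) = dist(b, b′)`), `cutoff_hdist_translate` (**the constructed `ζ_j` of (2.1) IS translation invariant on the tori** —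
  p13's `cutoff_invariant` with its hypothesis «whenever dist is» discharged for the distance of record), `bdist_translate` ((2.8) distance).
* §2 THE ONE-STEP BLOCK OPERATORS: `mem_Bs_translate_iff` ((2.15): `b + L·a ∈ B^s(c + a) ↔ b ∈ B^s(c)`), `qKer_translate`/`qstKer_translate`
  ((2.13)/(2.14): `Q(c + a, b + L·a) = Q(c, b)`), `qsKer_translate`/`qsstKer_translate` ((2.16)/(2.17)), `Qsstar_transl` (`Q^{s*}(τ_aB) =
  τ_{La}(Q^{s*}B)`), **`QsstarIter_transl`** (`Q^{s*}_k(τ_tB) = τ_{L^kt}(Q^{s*}_kB)`), `QsE_coarseTransl` (the same for p30's Euclidean `Q^{s*}_j`).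
* §3 THE MINIMIZER AND THE COVARIANCE OF [I]: **`HaxE_translate`** (`H_{j,Ax}(τ_tB) = τ_{L^jt}(H_{j,Ax}B)`: the axial minimizer (4.1.3) commutes
  with the translations — p30's `HaxOp = Q^{s*} − G_{Ax}∂^*∂Q^{s*}` with p27 g4's equivariance of `G_{j,Ax}`), `noZeroModes_Wstep` (no zero modes of
  `∂H_{j,Ax}` on `δ(QB)δ_{Ax}(B)` at every level `j + 1 ≤ m + K`, any `w > 0`, `c ≠ 0` — p30's `noZeroModes_DH` at the torus data; the level-0
  case is `BIJ85Eq317Torus.noZeroModes_Wstep0`), `coarseTransl_mem_Wstep_iff` (`δ(QB)δ_{Ax}(B)` is carried into itself by the block-lattice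
  translations), **`CE_translate`** (**`C^{(j)}(τ_{La}B) = τ_{La}(C^{(j)}B)`**, `a ∈ T^{(j+1)}`: the unit-lattice covariance (4.3.3) commutes with
  the block-lattice translations — the content of p. 261's «extend by translation invariance»), and the KERNEL forms **`hKer_translate`**
  (**«H_k is also translation invariant»: `H_j(b + L^jt, b₁ + t) = H_j(b, b₁)`**, p27's `HkE_translate` read entrywise), **`cKer_translate`**
  (`C^{(j)}(b₁ + L·a, b₂ + L·a) = C^{(j)}(b₁, b₂)`); and for the UNLOCALIZED propagator of record ([I] (4.4.4), p11's `DkE`, the «close to 𝒟_k»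
  partner of (2.12)): **`DkE_translate`** (`𝒟_k(τ_{L^kt}A) = τ_{L^kt}(𝒟_kA)`), `dkKernel_translate` (`𝒟_k(b + L^kt, b″ + L^kt) = 𝒟_k(b, b″)`),
  and for the axial propagator of [I] (5.2.2) (p11's `GaxE`): `GaxE_translate` (`G_{k,Ax}(τ_{L^kt}A) = τ_{L^kt}(G_{k,Ax}A)`).
* §4 THE LOCALIZED KERNELS OF (2.4)/(2.8)/(2.9)/(2.12): `hlKer_translate` (`H_{j,loc}(b + L^jt, b₁ + t) = H_{j,loc}(b, b₁)`), `ctKer_translate`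
  (`C̃^{(j)}`), `clKer_translate` (`C^{(j)}_{loc}(b₁ + L·a, b₂ + L·a) = C^{(j)}_{loc}(b₁, b₂)`), `termKer_translate` (the scale-`j` term
  `G^{(j),η}_{loc}(b + L^{j+1}a, b″ + L^{j+1}a) = G^{(j),η}_{loc}(b, b″)`), **`dkLocKer_translate`** (**`𝒟_{k,loc}(b + L^kt, b″ + L^kt) =
  𝒟_{k,loc}(b, b″)` for every `t ∈ T₁^{(k)}`**, every torus, `k ≤ m + K`, any `w > 0`, `c ≠ 0`, any radius schedule `ρ`), and the operator form
  `apply_dkLocKer_translate` (`(𝒟_{k,loc}τ_{L^kt}f)(b) = (𝒟_{k,loc}f)(b + L^kt)` for the weighted kernel action).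

HONEST SCOPE / DECLARED DIVERGENCES.  (i) Only the translations the block structure admits: `𝒟_{k,loc}` and the scale-`j` kernels `H_j`,
`H_{j,loc}` by the unit-lattice vectors of THEIR level (`t ∈ T^{(j)}` acting by `L^jt`), the unit-step objects `C^{(j)}`, `C̃^{(j)}`,
`C^{(j)}_{loc}`, `Q`, `Q^s` by the block-lattice vectors `L·a`, `a ∈ T^{(j+1)}` (these carry the constraints `QB = 0`, `δ_{Ax}(B)` of the step
`j → j+1`); rotations/reflections are not treated; the momentum representation is not constructed (for `σ_k` it is p27's `BIJ85Eq712Plancherel`).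
(ii) The print distinguishes the large reference torus `T_{0,η}` on which `H_k` is built from the torus `T_η` of the model (p. 260); the tree has
ONE torus per `Params` (r18 g10's reading «extend by translation invariance … is automatic on the torus»): what is certified here is the
invariance itself, on that torus.  (iii) The minimizer-based kernels need the standing hypotheses of p11's `HkE`/`CE` (`j ≤ m + K` resp.
`j + 1 ≤ m + K`, `w > 0`, `c ≠ 0`); the geometric statements need only the standing range.  (iv) `U = 1`, real abelian fields.  (v) No
def, no structure, no instance, no named fact; NOT summit progress.  Unit `lit-balaban-r18` (literature-prover-lit-balaban-r18-g13-0), 2026-08-22.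
-/

open scoped BigOperators RealInnerProductSpace

namespace Literature.MathematicalPhysics.QuantumFieldTheory.BalabanImbrieJaffe1984to88.BIJ88Sect2TranslInvTorus

open Balaban1983to89 hiding Site Plaq
open Balaban1983to89.LatticeFieldCalculus
open Balaban1983to89.B12GaugeFixInvariance269 (blockOf_add_scale)
open BIJ85AxialPropagator411 (BondSpace PlaqSpace toE curlOp V411 axialPropagator)
open BIJ85Prop521Torus (CoarseSpace toEj QcE QsE Wstep mem_Wstep QcE_QsE QcE_eq_zero_of_mem factor_V411)
open BIJ85Prop522Torus (HaxE CE HkE DkE GaxE hD_V411)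
open BIJ85Prop521Proof (HaxOp noZeroModes_DH)
open BIJ85Sigma422Equivariance (adjoint_intertwine axialPropagator_equivariant)
open BIJ85SigmaTranslationInvariance (translV translV_apply translV_zero translV_eq_zero_iff bondTransl bondTransl_apply plaqTransl
  toE_symm_bondTransl bondAvg_transl isAxial_transl_iff bondTransl_mem_V411_iff curlOp_bondTransl)
open BalabanJaffe1986.BJ86TranslInv246Torus (coarseTransl coarseTransl_apply coarseTransl_single HkE_translate)
open BIJ85Ineq722Torus (ctr distEU sitesPerDir_zero_eq)
open BIJ85Sect2SurfaceAverages BIJ85Eq219Proof BIJ85Eq213Adjoint BIJ88Eq211Proof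
open BIJ85Eq531Inputs (QsstarIter)
open BIJ85Ineq723TorusCE (toEj_single)
open BIJ88Sect2Statements (trunc loc)
open BIJ88Cutoffs21 (cutoff cutoff_congr_dist)
open BIJ88CurlyDkLocTorus
-- inside this namespace the bare `Site`/`Plaq` are the `ℤ^d` carriers of the QFT root; the torus ones are renamed:
open Balaban1983to89 renaming Site → TSite, Plaq → TPlaq

noncomputable section

variable {P : Params}

/-! ## §1  Geometry: the torus distances and the block centres under the lattice translations -/

/-- **the `ℓ^∞` torus distance is translation invariant**: `|(x + v) − (y + v)|_∞ = |x − y|_∞` (the distance of record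
`LatticeFieldCalculus.supDist` of [Balaban1982Higgs1] (1.3)). [cite: Balaban1982Higgs1, (1.3) p.604] -/
theorem supDist_translate {j : ℕ} (x y v : TSite P j) : supDist (x + v) (y + v) = supDist x y := by
  simp only [supDist, Site.add_apply, add_sub_add_right_eq_sub]

/-- casting multiples of `L^k`: labels congruent modulo the side of `T^{(k)}` give equal multiples of `L^k` modulo the side of `T^{(0)}`
(`N₀ = N_k·L^k` in the standing range, p09's `sitesPerDir_zero_eq`). [folklore] -/
private theorem natCast_mul_pow_eq_of_modEq {k : ℕ} (hk : k ≤ P.m + P.K) {x y : ℕ} (h : x ≡ y [MOD P.sitesPerDir k]) :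
    ((x * P.L ^ k : ℕ) : ZMod (P.sitesPerDir 0)) = ((y * P.L ^ k : ℕ) : ZMod (P.sitesPerDir 0)) := by
  rw [ZMod.natCast_eq_natCast_iff, sitesPerDir_zero_eq hk]
  exact h.mul_right' _

/-- **the fine vector of a unit-lattice translation, in coordinates**: `(L^k·t)_μ = t_μ·L^k` (`T4Covariance`'s `Site.scaleTo`, standing
range `k ≤ m + K`). [cite: Balaban1987RG1, (0.1) p.251] -/
theorem scaleTo_apply : ∀ {k : ℕ} (_ : k ≤ P.m + P.K) (t : TSite P k) (μ : Fin P.d),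
    Site.scaleTo k t μ = (((t μ).val * P.L ^ k : ℕ) : ZMod (P.sitesPerDir 0))
  | 0, _, t, μ => by simp only [Site.scaleTo_zero, pow_zero, mul_one, ZMod.natCast_zmod_val]
  | k + 1, hk, t, μ => by
    have hk' : k ≤ P.m + P.K := by omega
    rw [Site.scaleTo_succ, scaleTo_apply hk' (Site.scale t) μ, Site.scale_apply, Site.scaleCoord_apply, ZMod.val_natCast,
      natCast_mul_pow_eq_of_modEq hk' (Nat.mod_modEq _ _)]
    congr 1
    ring

/-- **block centres go to block centres**: `ctr(y + t) = ctr(y) + L^k·t` — the centre of `B^k(y + t)` (p09's `ctr`, a point of the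
`η`-lattice) is the translate of the centre of `B^k(y)` by the fine vector of `t` (standing range). [cite: Balaban1987RG1, (0.1) p.252] -/
theorem ctr_add {k : ℕ} (hk : k ≤ P.m + P.K) (y t : TSite P k) : ctr k (y + t) = ctr k y + Site.scaleTo k t := by
  funext μ
  have hmod : (y μ + t μ).val ≡ (y μ).val + (t μ).val [MOD P.sitesPerDir k] := by
    rw [ZMod.val_add]
    exact Nat.mod_modEq _ _
  show ((((y + t) μ).val * P.L ^ k + (P.L ^ k - 1) / 2 : ℕ) : ZMod (P.sitesPerDir 0)) = (ctr k y + Site.scaleTo k t) μ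
  rw [Site.add_apply (ctr k y), scaleTo_apply hk, Site.add_apply y t]
  show _ = (((y μ).val * P.L ^ k + (P.L ^ k - 1) / 2 : ℕ) : ZMod (P.sitesPerDir 0)) + _
  rw [Nat.cast_add, natCast_mul_pow_eq_of_modEq hk hmod, Nat.cast_add]
  push_cast
  ring

/-- **(2.1)/(2.4): the distance between `T_η` and `T₁^{(j)}` is translation invariant** — `dist(b + L^jt, b′ + t) = dist(b, b′)` for the
distance of record `hdist` (= p09's (7.2.2) distance `distEU` of the `η`-bond to the block centre): the geometric half of the printed
«translation invariant localization function ζ_k» (standing range `j ≤ m + K`). [cite: BalabanImbrieJaffe1988, (2.1) p.260] -/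
theorem hdist_translate {j : ℕ} (hj : j ≤ P.m + P.K) (t : TSite P j) (b : PBond P 0) (b₁ : PBond P j) :
    hdist (P := P) j (b.translate (Site.scaleTo j t)) (b₁.translate t) = hdist (P := P) j b b₁ := by
  simp only [hdist, distEU, PBond.translate_src, ctr_add hj, supDist_translate]

/-- **«Construct a translation invariant localization function ζ_k» (2.1), FOR THE CONSTRUCTED CUTOFF ON THE TORI**: p13's
`ζ_j = cutoff R₁ R₀ dist` at the distance of record satisfies `ζ_j(b + L^jt, b′ + t) = ζ_j(b, b′)` — p13's `cutoff_invariant`/`cutoff_congr_dist`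
with its hypothesis «whenever dist is» DISCHARGED by `hdist_translate` (any radii `R₁, R₀`). [cite: BalabanImbrieJaffe1988, (2.1) p.260] -/
theorem cutoff_hdist_translate {j : ℕ} (hj : j ≤ P.m + P.K) (R₁ R₀ : ℝ) (t : TSite P j) (b : PBond P 0) (b₁ : PBond P j) :
    cutoff R₁ R₀ (hdist (P := P) j) (b.translate (Site.scaleTo j t)) (b₁.translate t) = cutoff R₁ R₀ (hdist (P := P) j) b b₁ :=
  cutoff_congr_dist R₁ R₀ _ (hdist_translate hj t b b₁)

/-- **(2.8): the distance `dist(b₁, b₂) = |b₁₋ − b₂₋|_∞` on `T₁^{(j)}` is translation invariant**, `dist(b₁ + v, b₂ + v) = dist(b₁, b₂)`.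
[cite: BalabanImbrieJaffe1988, (2.8) p.261] -/
theorem bdist_translate {j : ℕ} (v : TSite P j) (b₁ b₂ : PBond P j) :
    bdist (P := P) j (b₁.translate v) (b₂.translate v) = bdist (P := P) j b₁ b₂ := by
  simp only [bdist, PBond.translate_src, supDist_translate]

/-! ## §2  The one-step block operators `Q`, `Q*`, `Q^s`, `Q^{s*}` under the block-lattice translations -/

/-- `b − v + v = b` on bonds. [folklore] -/
private theorem translate_neg_translate {j : ℕ} (v : TSite P j) (b : PBond P j) : (b.translate (-v)).translate v = b := by
  rw [PBond.translate_translate, neg_add_cancel]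
  cases b
  simp [PBond.translate]

/-- `b + v − v = b` on bonds. [folklore] -/
private theorem translate_translate_neg {j : ℕ} (v : TSite P j) (b : PBond P j) : (b.translate v).translate (-v) = b := by
  rw [PBond.translate_translate, add_neg_cancel]
  cases b
  simp [PBond.translate]

/-- `b + 0 = b` on bonds. [folklore] -/
private theorem translate_zero' {j : ℕ} (b : PBond P j) : b.translate 0 = b := by
  cases b
  simp [PBond.translate]

/-- the translation bijection of bonds, evaluated. [folklore] -/
private theorem translateEquiv_apply {j : ℕ} (v : TSite P j) (b : PBond P j) : PBond.translateEquiv v b = b.translate v := rfl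

/-- the translate of a coordinate bond field: `τ_vδ_b = δ_{b−v}`. [folklore] -/
private theorem translV_single {j : ℕ} (v : TSite P j) (b : PBond P j) :
    translV v (Pi.single b (1 : ℝ)) = Pi.single (b.translate (-v)) 1 := by
  funext b'
  rw [translV_apply]
  have h : b'.translate v = b ↔ b' = b.translate (-v) := (PBond.translateEquiv v).apply_eq_iff_eq_symm_apply
  simp [Pi.single_apply, h]

/-- **(2.15): blocks go to blocks for the surface sets** — `b + L·a ∈ B^s(c + a) ↔ b ∈ B^s(c)` on the tori (r15's `Bs` of
`torusBlockBonds`; `blockOf (x + L·a) = blockOf x + a`, standing range `j + 1 ≤ m + K`). [cite: BalabanImbrieJaffe1985, (2.15) p.304] -/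
theorem mem_Bs_translate_iff {j : ℕ} (hj : j + 1 ≤ P.m + P.K) (a : TSite P (j + 1)) (c : PBond P (j + 1)) (b : PBond P j) :
    b.translate (Site.scale a) ∈ (torusBlockBonds P j).Bs (c.translate a) ↔ b ∈ (torusBlockBonds P j).Bs c := by
  rw [mem_Bs_iff, mem_Bs_iff]
  simp only [PBond.tgt, PBond.translate_src, PBond.translate_dir, Site.shift_add, blockOf_add_scale hj, add_left_inj]

/-- the kernel of (2.13) as the average of a coordinate field: `Q(c, b) = (Qδ_b)(c)` (p31's `bondAvg_eq_sum_qKer`).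
[cite: BalabanImbrieJaffe1985, (2.13) p.304] -/
private theorem qKer_eq_bondAvg_single {j : ℕ} (c : PBond P (j + 1)) (b : PBond P j) :
    qKer P j c b = bondAvg (Pi.single b (1 : ℝ)) c := by
  rw [bondAvg_eq_sum_qKer, Finset.sum_eq_single b]
  · rw [Pi.single_eq_same, mul_one]
  · intro b' _ hb'
    rw [Pi.single_eq_of_ne hb', mul_zero]
  · intro h
    exact absurd (Finset.mem_univ b) h

/-- **the averaging kernel (2.13) is translation invariant on the tori**: `Q(c + a, b + L·a) = Q(c, b)` for p31's kernel of record `qKer`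
(p33's `Q(τ_{La}A) = τ_a(QA)` read on a coordinate field). [cite: BalabanImbrieJaffe1985, (2.13) p.304] -/
theorem qKer_translate {j : ℕ} (a : TSite P (j + 1)) (c : PBond P (j + 1)) (b : PBond P j) :
    qKer P j (c.translate a) (b.translate (Site.scale a)) = qKer P j c b := by
  have key : ∀ b₀ : PBond P j, qKer P j (c.translate a) b₀ = qKer P j c (b₀.translate (-Site.scale a)) := by
    intro b₀
    rw [qKer_eq_bondAvg_single, qKer_eq_bondAvg_single, ← translV_single, bondAvg_transl, translV_apply]
  rw [key, translate_translate_neg]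

/-- **the adjoint kernel `Q*(b, c) = L^dQ(c, b)` of (2.14) is translation invariant**: `Q*(b + L·a, c + a) = Q*(b, c)`.
[cite: BalabanImbrieJaffe1985, (2.14) p.304] -/
theorem qstKer_translate {j : ℕ} (a : TSite P (j + 1)) (b : PBond P j) (c : PBond P (j + 1)) :
    qstKer P j (b.translate (Site.scale a)) (c.translate a) = qstKer P j b c := by
  simp only [qstKer, qKer_translate]

/-- **the surface-average kernel (2.16) is translation invariant**: `Q^s(c + a, b + L·a) = Q^s(c, b)` (`qsKer` of `torusBlockBonds`).
[cite: BalabanImbrieJaffe1985, (2.16) p.304] -/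
theorem qsKer_translate {j : ℕ} (hj : j + 1 ≤ P.m + P.K) (a : TSite P (j + 1)) (c : PBond P (j + 1)) (b : PBond P j) :
    qsKer (torusBlockBonds P j) (c.translate a) (b.translate (Site.scale a)) = qsKer (torusBlockBonds P j) c b := by
  simp only [qsKer, mem_Bs_translate_iff hj]

/-- **the surface pull-back kernel (2.17) is translation invariant**: `Q^{s*}(b + L·a, c + a) = Q^{s*}(b, c)` (`qsstKer` of `torusBlockBonds`).
[cite: BalabanImbrieJaffe1985, (2.17) p.304] -/
theorem qsstKer_translate {j : ℕ} (hj : j + 1 ≤ P.m + P.K) (a : TSite P (j + 1)) (b : PBond P j) (c : PBond P (j + 1)) :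
    qsstKer (torusBlockBonds P j) (b.translate (Site.scale a)) (c.translate a) = qsstKer (torusBlockBonds P j) b c := by
  simp only [qsstKer, mem_Bs_translate_iff hj]

/-- **(2.17) is translation covariant on the tori**: `Q^{s*}(τ_aB) = τ_{La}(Q^{s*}B)` for r15's `Qsstar` of `torusBlockBonds` — the surface
sets go to surface sets (`mem_Bs_translate_iff`; standing range). [cite: BalabanImbrieJaffe1985, (2.17) p.304] -/
theorem Qsstar_transl {j : ℕ} (hj : j + 1 ≤ P.m + P.K) (a : TSite P (j + 1)) (B : PBond P (j + 1) → ℝ) :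
    (torusBlockBonds P j).Qsstar (translV a B) = translV (Site.scale a) ((torusBlockBonds P j).Qsstar B) := by
  funext b
  rw [translV_apply]
  unfold BlockBonds.Qsstar
  exact Fintype.sum_equiv (PBond.translateEquiv a) _ _ fun c => by
    simp only [translateEquiv_apply, translV_apply, mem_Bs_translate_iff hj]

/-- **(2.24): the k-fold surface pull-back `Q^{s*}_k = (Q^{s*})^k` is translation covariant** — `Q^{s*}_k(τ_tB) = τ_{L^kt}(Q^{s*}_kB)` for
`t ∈ T^{(k)}` (p30's `QsstarIter`; induction along `L^{k+1}t = L^k(L·t)`, standing range `k ≤ m + K`). [cite: BalabanImbrieJaffe1985, (2.24) p.305] -/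
theorem QsstarIter_transl : ∀ {k : ℕ} (_ : k ≤ P.m + P.K) (t : TSite P k) (B : PBond P k → ℝ),
    QsstarIter k (translV t B) = translV (Site.scaleTo k t) (QsstarIter (P := P) k B)
  | 0, _, _, _ => rfl
  | k + 1, hk, t, B => by
    show QsstarIter k ((torusBlockBonds P k).Qsstar (translV t B)) =
      translV (Site.scaleTo k (Site.scale t)) (QsstarIter k ((torusBlockBonds P k).Qsstar B))
    rw [Qsstar_transl hk, QsstarIter_transl (by omega) (Site.scale t)]

/-- `τ` under p30's identification `toEj`: `toEj⁻¹(τ_tB) = τ_t(toEj⁻¹B)`. [folklore] -/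
private theorem toEj_symm_coarseTransl {j : ℕ} (t : TSite P j) (B : CoarseSpace P j) :
    (toEj P j).symm (coarseTransl j t B) = translV t ((toEj P j).symm B) := by
  funext b
  show coarseTransl j t B b = B (b.translate t)
  exact coarseTransl_apply j t B b

/-- `τ` under p09's identification `toE`: `toE(τ_vA) = τ_v(toE A)`. [folklore] -/
private theorem toE_translV (v : TSite P 0) (A : VecField P 0 ℝ) : toE P (translV v A) = bondTransl v (toE P A) := by
  apply (toE P).symm.injective
  rw [LinearEquiv.symm_apply_apply, toE_symm_bondTransl, LinearEquiv.symm_apply_apply]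

/-- **(2.24) for p30's Euclidean `Q^{s*}_j`**: `Q^{s*}_j(τ_tB) = τ_{L^jt}(Q^{s*}_jB)` as vectors of p09's `BondSpace` (`QsE = toE ∘ Q^{s*}_j ∘ toEj⁻¹`).
[cite: BalabanImbrieJaffe1985, (2.24) p.305] -/
theorem QsE_coarseTransl {j : ℕ} (hj : j ≤ P.m + P.K) (t : TSite P j) (B : CoarseSpace P j) :
    QsE P j (coarseTransl j t B) = bondTransl (Site.scaleTo j t) (QsE P j B) := by
  rw [BIJ85Prop521Torus.QsE_apply, BIJ85Prop521Torus.QsE_apply, toEj_symm_coarseTransl, QsstarIter_transl hj, toE_translV]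

/-! ## §3  «H_k is also translation invariant»: the axial minimizer (4.1.3), the unit-lattice covariance (4.3.3) and the Landau
minimizer kernel under the translations -/

/-- **`H_{j,Ax}` (4.1.3) is translation covariant on the tori**: `H_{j,Ax}(τ_tB) = τ_{L^jt}(H_{j,Ax}B)` for p11's `HaxE` = p30's
`HaxOp = Q^{s*}_j − G_{j,Ax}∂^*∂Q^{s*}_j` — `Q^{s*}_j` (`QsE_coarseTransl`), `∂` (p33's `curlOp_bondTransl`), `∂^*` (p27 g4's `adjoint_intertwine`)
and `G_{j,Ax}` (p27 g4's `axialPropagator_equivariant`, the support `δ(Q_jA)δ_{j,Ax}(A)` being invariant: p33's `bondTransl_mem_V411_iff`) all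
commute with the translations; `j ≤ m + K`, `c ≠ 0`, `w > 0` (no zero modes, p11's `hD_V411`) — [I] p. 321 «σ_k is translation invariant» at the
level of the minimizer. [cite: BalabanImbrieJaffe1985, (4.1.3) p.310] -/
theorem HaxE_translate {j : ℕ} (hj : j ≤ P.m + P.K) {c : ℝ} (hc : c ≠ 0) {w : ℝ} (hw : 0 < w) (t : TSite P j) (B : CoarseSpace P j) :
    HaxE P w c j (coarseTransl j t B) = bondTransl (Site.scaleTo j t) (HaxE P w c j B) := by
  have hQ := QsE_coarseTransl hj t B
  have hD : ∀ A : BondSpace P,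
      curlOp (P := P) w c (bondTransl (Site.scaleTo j t) A) = plaqTransl (Site.scaleTo j t) (curlOp (P := P) w c A) :=
    curlOp_bondTransl w c _
  have hDs : ∀ g : PlaqSpace P, LinearMap.adjoint (curlOp (P := P) w c) (plaqTransl (Site.scaleTo j t) g) =
      bondTransl (Site.scaleTo j t) (LinearMap.adjoint (curlOp (P := P) w c) g) :=
    adjoint_intertwine _ _ _ hD
  have hG : ∀ J : BondSpace P, axialPropagator (V411 P j) (curlOp (P := P) w c) (bondTransl (Site.scaleTo j t) J) =
      bondTransl (Site.scaleTo j t) (axialPropagator (V411 P j) (curlOp (P := P) w c) J) :=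
    axialPropagator_equivariant (hD_V411 hj hc hw) _ _ (fun x hx => (bondTransl_mem_V411_iff j t x).2 hx)
      (fun x hx => (bondTransl_mem_V411_iff j t _).1 (by rwa [LinearIsometryEquiv.apply_symm_apply])) hD
  simp only [HaxE, HaxOp, LinearMap.sub_apply, LinearMap.comp_apply, hQ, hD, hDs, hG, map_sub]

/-- **no zero modes of `∂H_{j,Ax}` on `δ(QB)δ_{Ax}(B)`** at every level: for `j + 1 ≤ m + K`, `c ≠ 0`, `w > 0`, `∂(H_{j,Ax}B) = 0` with
`QB = 0`, `δ_{Ax}(B)` forces `B = 0` (so `C^{(j)}` of (4.3.3) is an honest second moment) — p30's `noZeroModes_DH` at the torus data of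
`factor_V411`, the level-`(j+1)` no-zero-modes being p11's `hD_V411` (the `j = 0` case is `BIJ85Eq317Torus.noZeroModes_Wstep0`).
[cite: BalabanImbrieJaffe1985, (4.3.3) p.311] -/
theorem noZeroModes_Wstep {j : ℕ} (hj : j + 1 ≤ P.m + P.K) {c : ℝ} (hc : c ≠ 0) {w : ℝ} (hw : 0 < w) :
    ∀ v : Wstep P j, (curlOp (P := P) w c ∘ₗ HaxE P w c j) (v : CoarseSpace P j) = 0 → v = 0 :=
  noZeroModes_DH (V := V411 P (j + 1)) (V' := V411 P j) (W := Wstep P j) (D := curlOp (P := P) w c) (Qc := QcE P j)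
    (Qs := QsE P j) (hD_V411 hj hc hw) (QcE_QsE (by omega)) (fun v => QcE_eq_zero_of_mem v.2) (factor_V411 (by omega))

/-- **the one-step constraint subspace `δ(QB)δ_{Ax}(B)` is carried into itself by the block-lattice translations**: `τ_{La}B ∈ Wstep ↔
B ∈ Wstep` (`Q(τ_{La}B) = τ_a(QB)`, and the axial trees go to axial trees — p33's `bondAvg_transl`, `isAxial_transl_iff`).
[cite: BalabanImbrieJaffe1985, (4.3.3) p.311] -/
theorem coarseTransl_mem_Wstep_iff {j : ℕ} (a : TSite P (j + 1)) (B : CoarseSpace P j) :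
    coarseTransl j (Site.scale a) B ∈ Wstep P j ↔ B ∈ Wstep P j := by
  rw [mem_Wstep, mem_Wstep, toEj_symm_coarseTransl, bondAvg_transl, isAxial_transl_iff, translV_eq_zero_iff]

/-- **«extend by translation invariance to T₁^{(k)}» (p. 261) — THE UNIT-LATTICE COVARIANCE `C^{(j)}` (4.3.3) COMMUTES WITH THE
BLOCK-LATTICE TRANSLATIONS OF THE TORI**: `C^{(j)}(τ_{La}B) = τ_{La}(C^{(j)}B)` for every `a ∈ T^{(j+1)}`, p11's `CE` = p30's second moment of
`½‖∂H_{j,Ax}B‖²` over `δ(QB)δ_{Ax}(B)`; by p27 g4's `axialPropagator_equivariant` with the three hypotheses discharged (`noZeroModes_Wstep`,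
`coarseTransl_mem_Wstep_iff`, `HaxE_translate` + `curlOp_bondTransl`); `j + 1 ≤ m + K`, `c ≠ 0`, `w > 0`. [cite: BalabanImbrieJaffe1988, (2.8) p.261] -/
theorem CE_translate {j : ℕ} (hj : j + 1 ≤ P.m + P.K) {c : ℝ} (hc : c ≠ 0) {w : ℝ} (hw : 0 < w) (a : TSite P (j + 1))
    (B : CoarseSpace P j) : CE P w c j (coarseTransl j (Site.scale a) B) = coarseTransl j (Site.scale a) (CE P w c j B) :=
  axialPropagator_equivariant (V := Wstep P j) (D := curlOp (P := P) w c ∘ₗ HaxE P w c j) (noZeroModes_Wstep hj hc hw)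
    (coarseTransl j (Site.scale a)) (plaqTransl (Site.scaleTo j (Site.scale a)))
    (fun x hx => (coarseTransl_mem_Wstep_iff a x).2 hx)
    (fun x hx => (coarseTransl_mem_Wstep_iff a _).1 (by rwa [LinearIsometryEquiv.apply_symm_apply]))
    (fun x => by rw [LinearMap.comp_apply, LinearMap.comp_apply, HaxE_translate (by omega) hc hw, curlOp_bondTransl]) B

/-- `τ_{−v}e_b = e_{b+v}` (p27's `coarseTransl_single`). [folklore] -/
private theorem coarseTransl_neg_single {j : ℕ} (v : TSite P j) (b : PBond P j) :
    coarseTransl j (-v) (EuclideanSpace.single b (1 : ℝ)) = EuclideanSpace.single (b.translate v) 1 := by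
  rw [coarseTransl_single, neg_neg]

/-- **«H_k is also translation invariant» (p. 260), FOR THE KERNEL OF RECORD**: `H_j(b + L^jt, b₁ + t) = H_j(b, b₁)` for every `t ∈ T^{(j)}`
— the (7.2.1)/(1.103) kernel `hKer` of p11's Landau minimizer `HkE` (p27 g10's operator statement `HkE_translate` read entrywise); every torus,
`j ≤ m + K`, `w > 0`, `c ≠ 0`. [cite: BalabanImbrieJaffe1988, (2.4) p.260] -/
theorem hKer_translate {j : ℕ} (hj : j ≤ P.m + P.K) {c : ℝ} (hc : c ≠ 0) {w : ℝ} (hw : 0 < w) (t : TSite P j) (b : PBond P 0)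
    (b₁ : PBond P j) : hKer (P := P) w c j (b.translate (Site.scaleTo j t)) (b₁.translate t) = hKer (P := P) w c j b b₁ := by
  rw [hKer, hKer, toEj_single b₁ 1, toEj_single (b₁.translate t) 1, ← coarseTransl_neg_single t b₁, HkE_translate hj hc hw, bondTransl_apply,
    PBond.translate_translate, map_neg, add_neg_cancel, translate_zero']

/-- **THE KERNEL FORM OF `CE_translate`: `C^{(j)}(b₁ + L·a, b₂ + L·a) = C^{(j)}(b₁, b₂)`** for MY kernel `cKer(b₁, b₂) = ⟨e_{b₁}, C^{(j)}e_{b₂}⟩`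
of the covariance of record — the translation invariance on `T₁^{(j)}` that p. 261 invokes to «extend» the cube-restricted `C̃^{(j)}`;
`j + 1 ≤ m + K`, `c ≠ 0`, `w > 0`. [cite: BalabanImbrieJaffe1988, (2.8) p.261] -/
theorem cKer_translate {j : ℕ} (hj : j + 1 ≤ P.m + P.K) {c : ℝ} (hc : c ≠ 0) {w : ℝ} (hw : 0 < w) (a : TSite P (j + 1))
    (b₁ b₂ : PBond P j) :
    cKer (P := P) w c j (b₁.translate (Site.scale a)) (b₂.translate (Site.scale a)) = cKer (P := P) w c j b₁ b₂ := by
  have hneg : -(Site.scale a) = Site.scale (-a) := (map_neg Site.scale a).symm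
  rw [cKer, cKer, toEj_single b₁ 1, toEj_single b₂ 1, toEj_single (b₁.translate (Site.scale a)) 1,
    toEj_single (b₂.translate (Site.scale a)) 1, ← coarseTransl_neg_single (Site.scale a) b₁,
    ← coarseTransl_neg_single (Site.scale a) b₂, hneg, CE_translate hj hc hw, LinearIsometryEquiv.inner_map_map]

/-- `𝒟_{k+1} = 𝒟_k + H_kC^{(k)}H_k*` for p11's operator sum (4.4.4). [cite: BalabanImbrieJaffe1985, (4.4.4) p.312] -/
private theorem DkE_succ (w c : ℝ) (k : ℕ) :
    DkE P w c (k + 1) = DkE P w c k + HkE P w c k ∘ₗ CE P w c k ∘ₗ LinearMap.adjoint (HkE P w c k) := by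
  simp only [DkE, Finset.sum_range_succ]

/-- **`𝒟_k = Σ_{j<k} H_jC^{(j)}H_j*` ([I] (4.4.4), the UNLOCALIZED propagator of record, p11's `DkE`) COMMUTES WITH THE UNIT-LATTICE
TRANSLATIONS**: `𝒟_k(τ_{L^kt}A) = τ_{L^kt}(𝒟_kA)` for every `t ∈ T₁^{(k)}` — term by term from `HkE_translate` (p27), its adjoint
(`adjoint_intertwine`) and `CE_translate`, by induction along `𝒟_{k+1} = 𝒟_k + H_kC^{(k)}H_k*` (`L^{k+1}t = L^k(L·t)`); every torus,
`k ≤ m + K`, `c ≠ 0`, `w > 0`.  (Row C1.Eq4.4.4 / C2.Eq2.12: the «close to 𝒟_k» partner of `𝒟_{k,loc}`.) [cite: BalabanImbrieJaffe1985, (4.4.4) p.312] -/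
theorem DkE_translate : ∀ {k : ℕ} (_ : k ≤ P.m + P.K) {c : ℝ} (_ : c ≠ 0) {w : ℝ} (_ : 0 < w) (t : TSite P k) (A : BondSpace P),
    DkE P w c k (bondTransl (Site.scaleTo k t) A) = bondTransl (Site.scaleTo k t) (DkE P w c k A)
  | 0, _, c, _, w, _, t, A => by simp [DkE]
  | k + 1, hk, c, hc, w, hw, t, A => by
    have hk' : k ≤ P.m + P.K := by omega
    rw [DkE_succ, LinearMap.add_apply, LinearMap.add_apply, map_add, Site.scaleTo_succ, DkE_translate hk' hc hw (Site.scale t) A]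
    simp only [LinearMap.comp_apply]
    rw [adjoint_intertwine (HkE P w c k) (coarseTransl k (Site.scale t)) (bondTransl (Site.scaleTo k (Site.scale t)))
        (HkE_translate hk' hc hw (Site.scale t)) A, CE_translate hk hc hw, HkE_translate hk' hc hw]

/-- `G_{k+1,Ax} = G_{k,Ax} + H_{k,Ax}C^{(k)}H*_{k,Ax}` for p11's operator sum (5.2.2). [cite: BalabanImbrieJaffe1985, (5.2.2) p.316] -/
private theorem GaxE_succ (w c : ℝ) (k : ℕ) :
    GaxE P w c (k + 1) = GaxE P w c k + HaxE P w c k ∘ₗ CE P w c k ∘ₗ LinearMap.adjoint (HaxE P w c k) := by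
  simp only [GaxE, Finset.sum_range_succ]

/-- **`G_{k,Ax} = Σ_{j<k} H_{j,Ax}C^{(j)}H*_{j,Ax}` ([I] (5.2.2), p11's `GaxE` = the axial propagator (4.1.1) on the tori by p30's
`torusPropagator_eq_GaxE`) COMMUTES WITH THE UNIT-LATTICE TRANSLATIONS**: `G_{k,Ax}(τ_{L^kt}A) = τ_{L^kt}(G_{k,Ax}A)`, `t ∈ T₁^{(k)}` — term
by term from `HaxE_translate`, its adjoint and `CE_translate`; `k ≤ m + K`, `c ≠ 0`, `w > 0`. [cite: BalabanImbrieJaffe1985, (5.2.2) p.316] -/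
theorem GaxE_translate : ∀ {k : ℕ} (_ : k ≤ P.m + P.K) {c : ℝ} (_ : c ≠ 0) {w : ℝ} (_ : 0 < w) (t : TSite P k) (A : BondSpace P),
    GaxE P w c k (bondTransl (Site.scaleTo k t) A) = bondTransl (Site.scaleTo k t) (GaxE P w c k A)
  | 0, _, c, _, w, _, t, A => by simp [GaxE]
  | k + 1, hk, c, hc, w, hw, t, A => by
    have hk' : k ≤ P.m + P.K := by omega
    rw [GaxE_succ, LinearMap.add_apply, LinearMap.add_apply, map_add, Site.scaleTo_succ, GaxE_translate hk' hc hw (Site.scale t) A]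
    simp only [LinearMap.comp_apply]
    rw [adjoint_intertwine (HaxE P w c k) (coarseTransl k (Site.scale t)) (bondTransl (Site.scaleTo k (Site.scale t)))
        (HaxE_translate hk' hc hw (Site.scale t)) A, CE_translate hk hc hw, HaxE_translate hk' hc hw]

/-- `τ_{−v}e_b = e_{b+v}` on the `η`-bonds (p27's `coarseTransl_single` at level `0`: p33's `bondTransl v` is `coarseTransl 0 v`). [folklore] -/
private theorem bondTransl_neg_single (v : TSite P 0) (b : PBond P 0) :
    bondTransl (-v) (EuclideanSpace.single b (1 : ℝ)) = EuclideanSpace.single (b.translate v) 1 :=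
  coarseTransl_neg_single (j := 0) v b

/-- p09's identification `toE` of a coordinate `η`-bond field is the Euclidean coordinate vector. [folklore] -/
private theorem toE_single' (b : PBond P 0) : toE P (Pi.single b (1 : ℝ)) = EuclideanSpace.single b 1 := rfl

/-- **THE KERNEL OF `𝒟_k` IS TRANSLATION INVARIANT**: `𝒟_k(b + L^kt, b″ + L^kt) = 𝒟_k(b, b″)` for the (4.4.4) kernel of record
`𝒟_k(b, b″) = (𝒟_ke_{b″})(b)` (p08's `dkKernel_eq_sum` reading), every `t ∈ T₁^{(k)}`; `k ≤ m + K`, `c ≠ 0`, `w > 0`.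
[cite: BalabanImbrieJaffe1985, (4.4.4) p.312] -/
theorem dkKernel_translate {k : ℕ} (hk : k ≤ P.m + P.K) {c : ℝ} (hc : c ≠ 0) {w : ℝ} (hw : 0 < w) (t : TSite P k)
    (b b'' : PBond P 0) :
    DkE P w c k (toE P (Pi.single (b''.translate (Site.scaleTo k t)) 1)) (b.translate (Site.scaleTo k t)) =
      DkE P w c k (toE P (Pi.single b'' 1)) b := by
  rw [toE_single' b'', toE_single' (b''.translate (Site.scaleTo k t)), ← bondTransl_neg_single (Site.scaleTo k t) b'', ← map_neg,
    DkE_translate hk hc hw, bondTransl_apply, PBond.translate_translate, map_neg, add_neg_cancel, translate_zero']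

/-! ## §4  The localized kernels (2.4), (2.8), (2.9), (2.12) under the translations -/

/-- **(2.4) ON THE TORI IS TRANSLATION INVARIANT**: `H_{j,loc}(b + L^jt, b₁ + t) = H_{j,loc}(b, b₁)` for MY `hlKer = ζ_j·H_j` (both factors are:
`cutoff_hdist_translate`, `hKer_translate`); any radii, `j ≤ m + K`, `w > 0`, `c ≠ 0`. [cite: BalabanImbrieJaffe1988, (2.4) p.260] -/
theorem hlKer_translate {j : ℕ} (hj : j ≤ P.m + P.K) {c : ℝ} (hc : c ≠ 0) {w : ℝ} (hw : 0 < w) (R₁ R₀ : ℝ) (t : TSite P j)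
    (b : PBond P 0) (b₁ : PBond P j) :
    hlKer (P := P) w c R₁ R₀ j (b.translate (Site.scaleTo j t)) (b₁.translate t) = hlKer (P := P) w c R₁ R₀ j b b₁ := by
  rw [hlKer_apply, hlKer_apply, cutoff_hdist_translate hj, hKer_translate hj hc hw]

/-- **(2.8) ON THE TORI IS TRANSLATION INVARIANT**: `C̃^{(j)}(b₁ + L·a, b₂ + L·a) = C̃^{(j)}(b₁, b₂)` for MY `ctKer` (the truncation radius is
measured in the invariant distance `bdist_translate`, the entries are `cKer_translate`); any radius `R`. [cite: BalabanImbrieJaffe1988, (2.8) p.261] -/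
theorem ctKer_translate {j : ℕ} (hj : j + 1 ≤ P.m + P.K) {c : ℝ} (hc : c ≠ 0) {w : ℝ} (hw : 0 < w) (R : ℝ) (a : TSite P (j + 1))
    (b₁ b₂ : PBond P j) :
    ctKer (P := P) w c R j (b₁.translate (Site.scale a)) (b₂.translate (Site.scale a)) = ctKer (P := P) w c R j b₁ b₂ := by
  rw [ctKer_apply, ctKer_apply, bdist_translate, cKer_translate hj hc hw]

/-- a product of translation-invariant kernels is translation invariant (reindex the middle sum by the translation). [folklore] -/
private theorem mul_apply_translate {α β γ : Type*} [Fintype β] (eα : α → α) (eβ : β ≃ β) (eγ : γ → γ) {A : Matrix α β ℝ}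
    {B : Matrix β γ ℝ} (hA : ∀ x y, A (eα x) (eβ y) = A x y) (hB : ∀ y z, B (eβ y) (eγ z) = B y z) (x : α) (z : γ) :
    (A * B) (eα x) (eγ z) = (A * B) x z := by
  rw [Matrix.mul_apply, Matrix.mul_apply]
  exact (Fintype.sum_equiv eβ (fun y => A x y * B y z) (fun y => A (eα x) y * B y (eγ z)) fun y => by rw [hA, hB]).symm

/-- the identity kernel is translation invariant (a translation is injective). [folklore] -/
private theorem one_apply_translate {β : Type*} {_ : DecidableEq β} (eβ : β ≃ β) (y y' : β) :
    (1 : Matrix β β ℝ) (eβ y) (eβ y') = (1 : Matrix β β ℝ) y y' := by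
  simp only [Matrix.one_apply, eβ.injective.eq_iff]

/-- the (2.9) sandwich of translation-invariant kernels is translation invariant. [cite: BalabanImbrieJaffe1988, (2.9) p.261] -/
private theorem clocKer_apply_translate {β κ : Type*} [Fintype β] [Fintype κ] {_ : DecidableEq β} (eβ : β ≃ β) (eκ : κ ≃ κ)
    {q : Matrix κ β ℝ} {qst : Matrix β κ ℝ} {qs : Matrix κ β ℝ} {qsst : Matrix β κ ℝ} {Ct : Matrix β β ℝ}
    (hq : ∀ x y, q (eκ x) (eβ y) = q x y) (hqst : ∀ y x, qst (eβ y) (eκ x) = qst y x)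
    (hqs : ∀ x y, qs (eκ x) (eβ y) = qs x y) (hqsst : ∀ y x, qsst (eβ y) (eκ x) = qsst y x)
    (hCt : ∀ y y', Ct (eβ y) (eβ y') = Ct y y') (y y' : β) :
    clocKer q qst qs qsst Ct (eβ y) (eβ y') = clocKer q qst qs qsst Ct y y' := by
  unfold clocKer
  have h1 : ∀ y y', ((1 : Matrix β β ℝ) - qsst * q) (eβ y) (eβ y') = ((1 : Matrix β β ℝ) - qsst * q) y y' := fun y y' => by
    rw [Matrix.sub_apply, Matrix.sub_apply, one_apply_translate, mul_apply_translate eβ eκ eβ hqsst hq]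
  have h2 : ∀ y y', ((1 : Matrix β β ℝ) - qst * qs) (eβ y) (eβ y') = ((1 : Matrix β β ℝ) - qst * qs) y y' := fun y y' => by
    rw [Matrix.sub_apply, Matrix.sub_apply, one_apply_translate, mul_apply_translate eβ eκ eβ hqst hqs]
  exact mul_apply_translate eβ eβ eβ (mul_apply_translate eβ eβ eβ h1 hCt) h2 y y'

/-- **(2.9) ON THE TORI IS TRANSLATION INVARIANT**: `C^{(j)}_{loc}(b₁ + L·a, b₂ + L·a) = C^{(j)}_{loc}(b₁, b₂)` for MY `clKer =
(I − Q^{s*}Q)C̃^{(j)}(I − Q*Q^s)` with p31's torus kernels — every factor is (`qKer_translate`, `qstKer_translate`, `qsKer_translate`,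
`qsstKer_translate`, `ctKer_translate`), the inner sums over `T^{(j)}`/`T^{(j+1)}` being reindexed by the translations; `j + 1 ≤ m + K`, `c ≠ 0`,
`w > 0`, any radius. [cite: BalabanImbrieJaffe1988, (2.9) p.261] -/
theorem clKer_translate {j : ℕ} (hj : j + 1 ≤ P.m + P.K) {c : ℝ} (hc : c ≠ 0) {w : ℝ} (hw : 0 < w) (R : ℝ) (a : TSite P (j + 1))
    (b₁ b₂ : PBond P j) :
    clKer (P := P) w c R j (b₁.translate (Site.scale a)) (b₂.translate (Site.scale a)) = clKer (P := P) w c R j b₁ b₂ := by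
  unfold clKer
  exact clocKer_apply_translate (PBond.translateEquiv (Site.scale a)) (PBond.translateEquiv a)
    (fun x y => qKer_translate a x y) (fun y x => qstKer_translate a y x) (fun x y => qsKer_translate hj a x y)
    (fun y x => qsstKer_translate hj a y x) (fun y y' => ctKer_translate hj hc hw R a y y') b₁ b₂

/-- **THE SCALE-`j` TERM OF (2.12) IS TRANSLATION INVARIANT**: `G^{(j),η}_{loc}(b + L^{j+1}a, b″ + L^{j+1}a) = G^{(j),η}_{loc}(b, b″)` for every
`a ∈ T^{(j+1)}` (`L^{j+1}a = L^j(L·a)`), MY `termKer = Σ_{b₁,b₂} H_{j,loc}(b,b₁)C^{(j)}_{loc}(b₁,b₂)H_{j,loc}(b″,b₂)` — reindex `b₁, b₂ ↦ b₁ + L·a,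
b₂ + L·a` and use `hlKer_translate` (with `t = L·a`), `clKer_translate`; `j + 1 ≤ m + K`, `c ≠ 0`, `w > 0`, any radius schedule `ρ`.
[cite: BalabanImbrieJaffe1988, (2.12) p.261] -/
theorem termKer_translate {j : ℕ} (hj : j + 1 ≤ P.m + P.K) {c : ℝ} (hc : c ≠ 0) {w : ℝ} (hw : 0 < w) (ρ : ℕ → ℝ)
    (a : TSite P (j + 1)) (b b'' : PBond P 0) :
    termKer (P := P) w c ρ j (b.translate (Site.scaleTo j (Site.scale a))) (b''.translate (Site.scaleTo j (Site.scale a))) =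
      termKer (P := P) w c ρ j b b'' := by
  unfold termKer
  symm
  refine Fintype.sum_equiv (PBond.translateEquiv (Site.scale a)) _ _ fun b₁ => ?_
  refine Fintype.sum_equiv (PBond.translateEquiv (Site.scale a)) _ _ fun b₂ => ?_
  rw [translateEquiv_apply, translateEquiv_apply, hlKer_translate (by omega) hc hw, clKer_translate hj hc hw,
    hlKer_translate (by omega) hc hw]

/-- **(2.12) ON THE TORI IS TRANSLATION INVARIANT**: `𝒟_{k,loc}(b + L^kt, b″ + L^kt) = 𝒟_{k,loc}(b, b″)` for every unit-lattice vector
`t ∈ T₁^{(k)}`, MY concrete `dkLocKer = Σ_{j<k} G^{(j),η}_{loc}` — each scale term is invariant under `L^kt = L^{j+1}(L^{k−j−1}t)`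
(`termKer_translate`, induction along `𝒟_{k+1,loc} = 𝒟_{k,loc} + G^{(k),η}_{loc}`); every torus, `k ≤ m + K`, `c ≠ 0`, `w > 0`, any radius
schedule `ρ` (in particular the printed `ρ_j = r(e_j)`).  With «H_k is also translation invariant» and «extend by translation invariance»
this is the translation invariance of every object of (2.12) for the concrete kernels of record. [cite: BalabanImbrieJaffe1988, (2.12) p.261] -/
theorem dkLocKer_translate : ∀ {k : ℕ} (_ : k ≤ P.m + P.K) {c : ℝ} (_ : c ≠ 0) {w : ℝ} (_ : 0 < w) (ρ : ℕ → ℝ) (t : TSite P k)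
    (b b'' : PBond P 0),
    dkLocKer (P := P) w c ρ k (b.translate (Site.scaleTo k t)) (b''.translate (Site.scaleTo k t)) = dkLocKer (P := P) w c ρ k b b''
  | 0, _, _, _, _, _, ρ, t, b, b'' => by simp [dkLocKer_eq_sum]
  | k + 1, hk, c, hc, w, hw, ρ, t, b, b'' => by
    rw [dkLocKer_succ, dkLocKer_succ, Site.scaleTo_succ, dkLocKer_translate (by omega) hc hw ρ (Site.scale t),
      termKer_translate hk hc hw]

/-- the weighted action of a translation-invariant `η`-lattice kernel commutes with the translations: `Σ_{b″} wK(b + v, b″)f(b″) =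
Σ_{b″} wK(b, b″)f(b″ + v)` whenever `K(b + v, b″ + v) = K(b, b″)`. [folklore] -/
private theorem weightedApply_translate (v : TSite P 0) {K : PBond P 0 → PBond P 0 → ℝ}
    (hK : ∀ b b'', K (b.translate v) (b''.translate v) = K b b'') (w' : ℝ) (f : PBond P 0 → ℝ) (b : PBond P 0) :
    ∑ b'', w' * K (b.translate v) b'' * f b'' = ∑ b'', w' * K b b'' * translV v f b'' :=
  (Fintype.sum_equiv (PBond.translateEquiv v) _ _ fun b'' => by rw [translateEquiv_apply, translV_apply, hK]).symm

/-- **THE OPERATOR FORM: `𝒟_{k,loc}` commutes with the unit-lattice translations** — for the weighted kernel action (p08's reading of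
record of (2.13), `(𝒟_{k,loc}f)(b) = Σ_{b″} η^d𝒟_{k,loc}(b, b″)f(b″)`, any weight `w′`): `(𝒟_{k,loc}f)(b + L^kt) = (𝒟_{k,loc}τ_{L^kt}f)(b)`;
`k ≤ m + K`, `c ≠ 0`, `w > 0`. [cite: BalabanImbrieJaffe1988, (2.13) p.261] -/
theorem apply_dkLocKer_translate {k : ℕ} (hk : k ≤ P.m + P.K) {c : ℝ} (hc : c ≠ 0) {w : ℝ} (hw : 0 < w) (ρ : ℕ → ℝ) (w' : ℝ)
    (t : TSite P k) (f : PBond P 0 → ℝ) (b : PBond P 0) :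
    ∑ b'', w' * dkLocKer (P := P) w c ρ k (b.translate (Site.scaleTo k t)) b'' * f b'' =
      ∑ b'', w' * dkLocKer (P := P) w c ρ k b b'' * translV (Site.scaleTo k t) f b'' :=
  weightedApply_translate _ (fun b b'' => dkLocKer_translate hk hc hw ρ t b b'') w' f b

end

end Literature.MathematicalPhysics.QuantumFieldTheory.BalabanImbrieJaffe1984to88.BIJ88Sect2TranslInvTorus
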